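import Mathlib
import Summits.ResolutionOfSingularities.ResolutionOfSingularities.Theorems.RadicialJungCleanModelsPointChainCleanSeq
import Summits.ResolutionOfSingularities.ResolutionOfSingularities.Theorems.RadicialJungCleanModelsCleanPermissibleSeqClean
import Summits.ResolutionOfSingularities.ResolutionOfSingularities.Theorems.RadicialJungCleanModelsL7bGlobal
import Literature.AlgebraicGeometry.Resolution.OrderSemicontinuity
import Literature.AlgebraicGeometry.Resolution.RegularCentreBlowupOrder
import Literature.AlgebraicGeometry.Resolution.BlowupOffCentre
import HarnessLib

/-!
# Route `RadicialJung`, crux `CleanModels` (stmt-ResolutionOfSingularities-15917), line `Sketch` rev 35, stub 6 `stub_cleanProp44` (X44c),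
# O8 in the OUTPUT CURRENCY of X44c: a chain of point blow-ups following a curve of the `μ`-stratum EXTENDS a clean-permissible sequence
# for the idealistic exponent `(J, μ)`

Memo `Cruxes/CleanModels/Lines/Sketch-memo-hand2-g10-stubs-5-7.md` §3.  `stub_cleanProp44` outputs `IsCleanPermissibleSeq p π J μ J' G` (centres inside
`{ord J' = μ}`, `J'` the iterated controlled transform).  Companion of ✓ `IsPointChainAlong.isCleanRegularCentreBlowupSeq` (p818820) in that currency:
if `π : X₁ → X` is a clean-permissible sequence for `(J, μ)` with transform `J₁` (`ord J₁ ≤ μ` everywhere), the line of `G` clean-regular everywhere on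
`X` (`char p`), `X₁` regular Noetherian quasi-excellent, `C₀ ⊆ X₁` a regular curve INSIDE THE STRATUM `{ord J₁ = μ}`, and `σ : X' → X₁` a chain of point
blow-ups following `C₀` at a closed point of `dim 3` lying in the closure of the rest of `C₀`, then for the iterated controlled transform `J'`:
`σ ≫ π` is a clean-permissible sequence for `(J, μ)` with transform `J'`, `ord J' ≤ μ` everywhere (✓ `IsBlowup.idealOrder_controlledTransform_le_of_forall`,
[CoP1] 4.2 (a)), the strict transform `C` lies in `{ord J' = μ}` (off the base point ✓ `IsBlowup.idealOrder_controlledTransform_of_not_mem`; at the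
end point by upper semicontinuity ✓ `isClosed_setOf_le_idealOrder_of_isJ2`), and `ord J'` agrees with `ord J₁ ∘ σ` off the base point
(`IsPointChainAlong.isCleanPermissibleSeq`; each step ✓ `IsCleanPermissibleSeq.cons_point`).

Honest framing: OURS (bookkeeping: the insertion chains of L7b are legal steps of X44c's output predicate); nothing here proves X44c or any case of `CleanModels`.
-/

noncomputable section

set_option linter.dupNamespace false -- mandated namespace of this single-conjunct summit

open CategoryTheory AlgebraicGeometry TopologicalSpace IsLocalRing Opposite
open Literature.AlgebraicGeometry.Resolution Literature.AlgebraicGeometry.Motives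
open Scheme.IdealSheafData

namespace Summit.ResolutionOfSingularities.ResolutionOfSingularities.Theorems.RadicialJung.CleanModels

/-- **A chain of point blow-ups following a curve of the `μ`-stratum extends a clean-permissible sequence for `(J, μ)`.**  See the module docstring.
[cite: CossartPiltant2008, Prop. 4.2 (a)] [cite: CossartPiltant2019, Prop. 4.4 (i)] [cite: Piltant2013, §2 Axiom 2 (ii)] -/
theorem IsPointChainAlong.isCleanPermissibleSeq {p : ℕ} (hp : p.Prime) {X X₁ : Scheme.{0}} [IsIntegral X] [IsIntegral X₁] [IsNoetherian X₁]
    {π : X₁ ⟶ X} [IsDominant π] {J : X.IdealSheafData} {μ : ℕ} {J₁ : X₁.IdealSheafData} {G : X.functionField} [CharP X.functionField p]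
    (hπ : IsCleanPermissibleSeq p π J μ J₁ G) (hG : ∀ x : X, CleanRegAt p (algebraMap (X.presheaf.stalk x) X.functionField) G)
    (hX₁ : Scheme.IsRegular X₁) (hE₁ : Scheme.IsQuasiExcellent X₁) (hJ₁le : ∀ x : X₁, idealOrder J₁ x ≤ μ) {C₀ : Closeds X₁}
    (hC₀reg : ∀ y ∈ (C₀ : Set X₁), ∃ c : Fin 2 → X₁.presheaf.stalk y, IsRsopPart c ∧ Ideal.span (Set.range c) = stalkIdeal (vanishingIdeal C₀) y)
    (hC₀μ : ∀ y ∈ (C₀ : Set X₁), idealOrder J₁ y = μ)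
    {X' : Scheme.{0}} [IsLocallyNoetherian X'] {σ : X' ⟶ X₁} {C : Closeds X'} {x : X'} {n : ℕ} (h : IsPointChainAlong σ C₀ C x n)
    (hxC₀ : σ x ∈ (C₀ : Set X₁)) (hdim₀ : ringKrullDim (X₁.presheaf.stalk (σ x)) = 3) (hx₀cl : IsClosed ({σ x} : Set X₁))
    (h0 : σ x ∈ closure ((C₀ : Set X₁) \ {σ x})) :
    ∃ (_ : IsIntegral X') (_ : IsDominant σ) (J' : X'.IdealSheafData), IsCleanPermissibleSeq p (σ ≫ π) J μ J' G ∧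
      (∀ x' : X', idealOrder J' x' ≤ μ) ∧ (∀ y ∈ (C : Set X'), idealOrder J' y = μ) ∧
      (∀ y : X', σ y ≠ σ x → idealOrder J' y = idealOrder J₁ (σ y)) := by
  induction h with
  | nil C₀ x₀ =>
    refine ⟨inferInstance, inferInstance, J₁, by simpa using hπ, hJ₁le, hC₀μ, fun y _ => by simp⟩
  | @cons Xm Xt _ _ σ C₀ C n τ x' hx hchain hYreg hτ hx' ih =>
    have hστ : (τ ≫ σ) x' = σ (τ x') := by rw [Scheme.Hom.comp_apply]
    rw [hστ] at hxC₀ hdim₀ hx₀cl h0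
    obtain ⟨hXint, hσdom, J', hseq, hle, hCμ, hoff⟩ := ih hC₀reg hC₀μ hxC₀ hdim₀ hx₀cl h0
    haveI := hXint
    haveI := hσdom
    obtain ⟨hXreg, hCreg, hxC, hdimx⟩ := data_along_pointChain hchain hX₁ hC₀reg hxC₀ hdim₀
    have hXE : Scheme.IsQuasiExcellent _ := hchain.isQuasiExcellent hE₁
    -- the centre ideal is nonzero
    have hYbot : vanishingIdeal (⟨{τ x'}, hx⟩ : Closeds _) ≠ ⊥ := by
      intro hbot
      obtain ⟨c, hc, hspan⟩ := hCreg (τ x') hxC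
      haveI := hc.1
      have hPle : stalkIdeal (vanishingIdeal C) (τ x') ≤ maximalIdeal _ :=
        (mem_support_iff_stalkIdeal_le _ _).mp
          (by rw [← SetLike.mem_coe, Scheme.IdealSheafData.coe_support_vanishingIdeal]; exact hxC)
      have hc0 : c 0 ∈ stalkIdeal (vanishingIdeal (⟨{τ x'}, hx⟩ : Closeds _)) (τ x') := by
        rw [stalkIdeal_vanishingIdeal_singleton hx]
        exact hPle (hspan ▸ Ideal.subset_span ⟨0, rfl⟩)
      rw [hbot, stalkIdeal_bot, Ideal.mem_bot] at hc0
      exact hc.ne_zero 0 hc0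
    haveI : IsIntegral _ := hτ.isIntegral hYbot
    haveI : IsDominant τ := isDominant_of_isBlowup_of_ne_bot hτ hYbot
    -- the new stage is Noetherian (for upper semicontinuity of the order)
    haveI : IsProper σ := hchain.isProper
    haveI : IsProper τ := hτ.isProper
    haveI : CompactSpace Xt := QuasiCompact.compactSpace_of_compactSpace (τ ≫ σ)
    haveI : IsNoetherian Xt := {}
    -- the step
    have hint := isIntegral_subscheme_vanishingIdeal_singleton hx
    have hord : idealOrder J' (τ x') = μ := hCμ _ hxC
    have key := IsCleanPermissibleSeq.cons_point hp τ (σ ≫ π) J μ J' G hseq (τ x') hx hint hYreg hord hτ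
      (hseq.cleanRegAt hp inferInstance hG (τ x'))
    set J'' := controlledTransform τ (vanishingIdeal (⟨{τ x'}, hx⟩ : Closeds _)) J' μ with hJ''
    -- orders of `J''`
    have hY : ∀ y ∈ ((⟨{τ x'}, hx⟩ : Closeds _) : Set _), idealOrder J' y = μ := by
      intro y hy
      have hy' : y = τ x' := hy
      subst hy'
      exact hord
    have hle'' : ∀ z, idealOrder J'' z ≤ μ := fun z => hτ.idealOrder_controlledTransform_le_of_forall hXreg hYreg hY hle z
    have hoff'' : ∀ z, τ z ≠ τ x' → idealOrder J'' z = idealOrder J' (τ z) := by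
      intro z hz
      refine hτ.idealOrder_controlledTransform_of_not_mem J' μ ?_
      rw [Scheme.IdealSheafData.coe_support_vanishingIdeal]
      exact hz
    have hne'' : J'' ≠ ⊥ := by
      intro hbot
      have h1 : ((μ + 1 : ℕ) : ℕ∞) ≤ idealOrder J'' x' := by
        rw [le_idealOrder_iff, hbot, stalkIdeal_bot]; exact bot_le
      have h2 : ((μ + 1 : ℕ) : ℕ∞) ≤ (μ : ℕ∞) := h1.trans (hle'' x')
      exact (not_le.mpr (by exact_mod_cast Nat.lt_succ_self μ)) h2
    have hX' : Scheme.IsRegular _ := (strictTransform_curve_data_of_isBlowup_point hXreg hx hYreg hτ hCreg hxC hdimx hx').1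
    have hclosed : IsClosed {z | (μ : ℕ∞) ≤ idealOrder J'' z} :=
      isClosed_setOf_le_idealOrder_of_isJ2 hX' (fun U => (hτ.isQuasiExcellent hXE U).2) hne'' μ
    have hCμ'' : ∀ y ∈ closure (τ ⁻¹' ((C : Set _) \ {τ x'})), idealOrder J'' y = μ := by
      have hsub : τ ⁻¹' ((C : Set _) \ {τ x'}) ⊆ {z | (μ : ℕ∞) ≤ idealOrder J'' z} := by
        rintro z ⟨hzC, hzx⟩
        change (μ : ℕ∞) ≤ idealOrder J'' z
        rw [hoff'' z hzx, hCμ _ hzC]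
      intro y hy
      exact le_antisymm (hle'' y) ((hclosed.closure_subset_iff.mpr hsub) hy)
    refine ⟨inferInstance, inferInstance, J'', by simpa only [Category.assoc] using key, hle'', hCμ'', fun y hy => ?_⟩
    have hy' : σ (τ y) ≠ σ (τ x') := by
      intro heq; apply hy; rw [Scheme.Hom.comp_apply, Scheme.Hom.comp_apply, heq]
    have hne : τ y ≠ τ x' := fun heq => hy' (by rw [heq])
    rw [Scheme.Hom.comp_apply, hoff'' y hne, hoff _ hy']

end Summit.ResolutionOfSingularities.ResolutionOfSingularities.Theorems.RadicialJung.CleanModels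

end
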